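import Summits.BirchSwinnertonDyer.Rank1Residual.X4.LevelLoweringOfOldOnCycles
import HarnessLib

/-!
# EXACTNESS ON CYCLES ⟹ EXACTNESS ON PATH FUNCTIONS: the hypothesis `hexact` of the additive certificate (`X4/KuriharaAdditiveCertificateOfExactness`, `…TwistOfExactness`) for path-function sets follows from the exactness of the signed old-space complex on Hecke-stable, closing-supported families of functionals on `H₁` (cell `b2b-bsdres`, seat additive-p4 gen 32, line V54/V55-A3)

HONEST FRAMING (verbatim, cell `b2b-bsdres`): the goal of the cell is to DELETE the COMBINATION-SHAPED
residual classes for ALL analytic-rank `≤ 1` curves over `ℚ` — "full BSD formula for every rank `≤ 1`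
curve in class `C`" assembled STRICTLY from published theorems — so that the rank-`≤ 1` remainder
becomes exactly the CONSTRUCTION-SHAPED classes, which are TYPED (missing-input Props), NOT attempted;
this is not "finishing BSD". This file: TOOL theorems (modular symbols / period homology), 0 defs, 0
facts, nothing booked; X4 CONSTRUCTION-SHAPED.

## What is proved

Levels `M₀ ∣ M₁, M₂ ∣ N` with degeneracy indices `1, ℓ₂ : M₀ → M₁`, `1, ℓ₁ : M₀ → M₂`, `1, ℓ₁ : M₁ → N`,
`1, ℓ₂ : M₂ → N` (on the rows `M₀ = N/ℓ₁ℓ₂`, `M_i = N/ℓ_i`); signs `w₁, w₂`; a closing prime `q₀ ≡ 1 (mod N)`;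
path functions `μ_Λ(r) = Λ((T_{q₀} − q₀ − 1)•{∞, r})` (K92) of functionals additive on `H₁`.

* `pathFun_sub_smul_comp_eq'` — general-level form of K94's identity:
  `μ_Λ(r) − w·μ_Λ(ℓr) = (Λ∘α_* − w·Λ∘β_*)((T_{q₀} − q₀ − 1)•{∞, r}_N)` for `M·1 ∣ N`, `M·ℓ ∣ N`.
* **`exact_pathFun_of_exact_cycles`** — families `𝓛₁, 𝓛₂, 𝓛₀` of additive functionals with: `𝓛₁, 𝓛₂`
  stable under `Λ ↦ Λ∘(A•)` (`A = T_{q₀} − q₀ − 1`) and under differences, containing the pull-backs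
  `Λ₀∘(α − w₂β)_*`, `−Λ₀∘(α − w₁β)_*` of `𝓛₀`, and `A`-SUPPORTED (`Λ∘(A•) = 0 on H₁ ⟹ Λ = 0 on H₁`); `A`
  SURJECTIVE on `𝓛₀` (`Λ₀' = Λ₀∘(A•)`); and CYCLE-EXACTNESS: every `(Λ₁, Λ₂) ∈ 𝓛₁ × 𝓛₂` with
  `Λ₁∘(α¹ − w₁β¹)_* + Λ₂∘(α² − w₂β²)_* = 0` on `H₁(X₀(N), ℤ)` is `(Λ₀∘(α−w₂β)_*, −Λ₀∘(α−w₁β)_*)` on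
  `H₁(X₀(M₁))`, `H₁(X₀(M₂))` for some `Λ₀ ∈ 𝓛₀`. THEN the path-function sets `P_i = {μ_Λ : Λ ∈ 𝓛_i}`
  satisfy the `hexact` hypothesis of K91/K93: every `(g, h) ∈ P₁ × P₂` with
  `(g − w₁g∘[ℓ₁]) + (h − w₂h∘[ℓ₂]) = 0` is `(z − w₂z∘[ℓ₂], −(z − w₁z∘[ℓ₁]))` with `z ∈ P₀`. PROOF: the
  function identity says `Λ₁∘d¹_* + Λ₂∘d²_*` kills `A•H₁(X₀(N))` (every cycle is ONE period functional);
  `A` commutes with the push-forwards, so `(Λ₁∘A, Λ₂∘A)` is a cycle-level kernel pair; cycle-exactness,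
  division by `A` on `𝓛₀`, and `A`-support give `Λ₁ = Λ₀∘(α−w₂β)_*`, `Λ₂ = −Λ₀∘(α−w₁β)_*`; `z = μ_{Λ₀}`.

With K92 (stability), K94 (injectivity from Ihara) and this file, the structural hypotheses of
`plusSymbolLevelLowersAdditivelyModAt_of_exact` / `…_of_ratTwist_of_exact` are statements about
functionals on `H₁` of the four modular curves: the per-row EVIDENCE is the cycle-level FREE
decomposition and the cycle-level exactness at the f-block (instrument E11); on the rows the families are
the f-block parts of `Hom(H₁, ℤ/p^e)`, where `A` acts bijectively (`a_{q₀} ≢ q₀ + 1 mod p`).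

## References

* Ju. I. Manin, Izv. Akad. Nauk SSSR 36 (1972), Thm. 3.3 (20), Thm. 3.5 (22). [cite: Manin1972, Thm. 3.3 (20) and Thm. 3.5 (22)]
* F. Diamond, J. Shurman, *A First Course in Modular Forms* (2005), Prop. 5.6.2. [cite: DiamondShurman2005, Prop. 5.6.2]
* J. E. Cremona, *Algorithms for modular elliptic curves* (1997), Lemma 2.1.1, §2.4. [cite: CremonaAlgorithms1997, Lemma 2.1.1]
* K. A. Ribet, Proc. ICM 1983 (1984), Thm. 4.1 (provenance of the exactness hypothesis, one prime). [cite: Ribet1984ICM, Thm. 4.1]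
-/

noncomputable section

open scoped MatrixGroups ModularForm

open CongruenceSubgroup Finset Matrix

open Literature.NumberTheory.EllipticCurves Literature.NumberTheory.EllipticCurves.ModularForms
  Literature.NumberTheory.EllipticCurves.ModularForms.HidaCohomology

namespace Summit.BirchSwinnertonDyer.Rank1Residual.LevelLowering

section ExactOfCycles

variable {k : Type*} [CommRing k]

/-- **General-level form of `pathFun_sub_smul_comp_eq`**: for `M·1 ∣ N`, `M·ℓ ∣ N`, a prime `q₀ ∤ N`,
`μ(r) = c·Λ((T_{q₀} − q₀ − 1)•{∞, r}_M)`: `μ(r) − w·μ(ℓr) = c·(Λ∘α_* − w·Λ∘β_*)((T_{q₀} − q₀ − 1)•{∞, r}_N)`.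
[cite: DiamondShurman2005, Prop. 5.6.2] [cite: CremonaAlgorithms1997, Lemma 2.1.1] -/
theorem pathFun_sub_smul_comp_eq' {M N ℓ : ℕ} [NeZero M] [NeZero N] [NeZero ℓ]
    (h1 : M * 1 ∣ N) (hℓ : M * ℓ ∣ N)
    (Λ : Module.Dual ℂ (CuspForm (Gamma0 M) 2) → k)
    (σM : ℚ → Module.Dual ℂ (CuspForm (Gamma0 M) 2))
    (hσM : ∀ (r : ℚ) (f : CuspForm (Gamma0 M) 2), σM r f = modularSymbol f r)
    (σN : ℚ → Module.Dual ℂ (CuspForm (Gamma0 N) 2))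
    (hσN : ∀ (r : ℚ) (f : CuspForm (Gamma0 N) 2), σN r f = modularSymbol f r)
    {q₀ : ℕ} (hq₀ : q₀.Prime) (hq₀N : ¬ q₀ ∣ N) (c w : k) (μ : ℚ → k)
    (hμ : ∀ r, μ r = c * Λ (HeckeRing0.T M 2 q₀ hq₀ • σM r - ((q₀ + 1 : ℕ) : ℂ) • σM r)) (r : ℚ) :
    μ r - w * μ (ℓ * r) =
      c * (fun z ↦ Λ ((degeneracyMap0 M N 1 2).dualMap z) - w * Λ ((degeneracyMap0 M N ℓ 2).dualMap z))
        (HeckeRing0.T N 2 q₀ hq₀ • σN r - ((q₀ + 1 : ℕ) : ℂ) • σN r) := by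
  have hα : (degeneracyMap0 M N 1 2).dualMap (σN r) = σM r := by
    rw [dualMap_degeneracyMap0_symbol h1 σN hσN σM hσM r, Nat.cast_one, one_mul]
  have hβ : (degeneracyMap0 M N ℓ 2).dualMap (σN r) = σM (ℓ * r) :=
    dualMap_degeneracyMap0_symbol hℓ σN hσN σM hσM r
  have hA : ∀ (d : ℕ) [NeZero d], M * d ∣ N →
      (degeneracyMap0 M N d 2).dualMap (HeckeRing0.T N 2 q₀ hq₀ • σN r - ((q₀ + 1 : ℕ) : ℂ) • σN r) =
        HeckeRing0.T M 2 q₀ hq₀ • (degeneracyMap0 M N d 2).dualMap (σN r) -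
          ((q₀ + 1 : ℕ) : ℂ) • (degeneracyMap0 M N d 2).dualMap (σN r) := by
    intro d _ hd
    rw [map_sub, dualMap_degeneracyMap0_T_smul hd hq₀ hq₀N, LinearMap.map_smul]
  simp only [hμ]
  rw [hA 1 h1, hA ℓ hℓ, hα, hβ]
  ring

/-- The closing operator commutes with a push-forward on cycles:
`α_{d,*}((T_{q₀} − q₀ − 1)•z) = (T_{q₀} − q₀ − 1)•α_{d,*} z`. [cite: DiamondShurman2005, Prop. 5.6.2] -/
theorem dualMap_degeneracyMap0_closing {M N d : ℕ} [NeZero M] [NeZero N] [NeZero d] (hd : M * d ∣ N)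
    {q₀ : ℕ} (hq₀ : q₀.Prime) (hq₀N : ¬ q₀ ∣ N) (z : Module.Dual ℂ (CuspForm (Gamma0 N) 2)) :
    (degeneracyMap0 M N d 2).dualMap (HeckeRing0.T N 2 q₀ hq₀ • z - ((q₀ + 1 : ℕ) : ℂ) • z) =
      HeckeRing0.T M 2 q₀ hq₀ • (degeneracyMap0 M N d 2).dualMap z -
        ((q₀ + 1 : ℕ) : ℂ) • (degeneracyMap0 M N d 2).dualMap z := by
  rw [map_sub, dualMap_degeneracyMap0_T_smul hd hq₀ hq₀N, LinearMap.map_smul]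

/-- Every cycle of `H₁(X₀(N), ℤ)` is ONE period functional `{∞, γ∞}`, i.e. `0` or a symbol
functional `{∞, a/c}` (Cremona Lemma 2.1.1; tree `coe_periodHomology_eq_range`). [cite: CremonaAlgorithms1997, Lemma 2.1.1] -/
theorem exists_eq_zero_or_eq_symbol_of_mem_periodHomology {N : ℕ} [NeZero N]
    (σ : ℚ → Module.Dual ℂ (CuspForm (Gamma0 N) 2))
    (hσ : ∀ (r : ℚ) (f : CuspForm (Gamma0 N) 2), σ r f = modularSymbol f r)
    {x : Module.Dual ℂ (CuspForm (Gamma0 N) 2)} (hx : x ∈ periodHomology N) :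
    x = 0 ∨ ∃ r : ℚ, x = σ r := by
  have hx' : x ∈ (periodHomology N : Set (Module.Dual ℂ (CuspForm (Gamma0 N) 2))) := hx
  rw [coe_periodHomology_eq_range] at hx'
  obtain ⟨γ, rfl⟩ := hx'
  by_cases hc : ((γ : SL(2, ℤ)) 1 0 : ℤ) = 0
  · left
    ext f
    simp [periodFunctional_apply, cuspSymbol, hc]
  · right
    refine ⟨(((γ : SL(2, ℤ)) 0 0 : ℤ) : ℚ) / (((γ : SL(2, ℤ)) 1 0 : ℤ) : ℚ), ?_⟩
    ext f
    simp [periodFunctional_apply, cuspSymbol, hc, hσ]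

/-- An additive function on `H₁` vanishes at `0`. [folklore] -/
private theorem apply_zero_of_additiveOn' {N : ℕ} [NeZero N] (Φ : Module.Dual ℂ (CuspForm (Gamma0 N) 2) → k)
    (hadd : ∀ x ∈ periodHomology N, ∀ y ∈ periodHomology N, Φ (x + y) = Φ x + Φ y) : Φ 0 = 0 := by
  have h := hadd 0 (periodHomology N).zero_mem 0 (periodHomology N).zero_mem
  rw [add_zero] at h
  linear_combination -h

/-- **EXACTNESS ON CYCLES ⟹ EXACTNESS ON PATH FUNCTIONS** (see the module docstring for the data and the
proof). The conclusion is literally the hypothesis `hexact` of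
`X4/KuriharaAdditiveCertificateTwistOfExactness.exists_families_of_exact` (signs `w₁, w₂`; for
`w₁ = w₂ = 1` that of `X4/KuriharaAdditiveCertificateOfExactness.plusSymbolLevelLowersAdditivelyModAt_of_exact`)
for the path-function sets `P_i = {r ↦ Λ((T_{q₀} − q₀ − 1)•{∞, r}) : Λ ∈ 𝓛_i}`.
[cite: Manin1972, Thm. 3.3 (20) and Thm. 3.5 (22)] [cite: DiamondShurman2005, Prop. 5.6.2]
[cite: CremonaAlgorithms1997, Lemma 2.1.1] -/
theorem exact_pathFun_of_exact_cycles {M₀ M₁ M₂ N ℓ₁ ℓ₂ : ℕ}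
    [NeZero M₀] [NeZero M₁] [NeZero M₂] [NeZero N] [NeZero ℓ₁] [NeZero ℓ₂]
    (h01 : M₀ * 1 ∣ M₁) (h01' : M₀ * ℓ₂ ∣ M₁) (h02 : M₀ * 1 ∣ M₂) (h02' : M₀ * ℓ₁ ∣ M₂)
    (h1N : M₁ * 1 ∣ N) (h1N' : M₁ * ℓ₁ ∣ N) (h2N : M₂ * 1 ∣ N) (h2N' : M₂ * ℓ₂ ∣ N)
    (σ0 : ℚ → Module.Dual ℂ (CuspForm (Gamma0 M₀) 2))
    (hσ0 : ∀ (r : ℚ) (f : CuspForm (Gamma0 M₀) 2), σ0 r f = modularSymbol f r)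
    (σ1 : ℚ → Module.Dual ℂ (CuspForm (Gamma0 M₁) 2))
    (hσ1 : ∀ (r : ℚ) (f : CuspForm (Gamma0 M₁) 2), σ1 r f = modularSymbol f r)
    (σ2 : ℚ → Module.Dual ℂ (CuspForm (Gamma0 M₂) 2))
    (hσ2 : ∀ (r : ℚ) (f : CuspForm (Gamma0 M₂) 2), σ2 r f = modularSymbol f r)
    (σN : ℚ → Module.Dual ℂ (CuspForm (Gamma0 N) 2))
    (hσN : ∀ (r : ℚ) (f : CuspForm (Gamma0 N) 2), σN r f = modularSymbol f r)
    {q₀ : ℕ} (hq₀ : q₀.Prime) (hq₀1 : q₀ ≡ 1 [MOD N]) (hq₀N : ¬ q₀ ∣ N) (w₁ w₂ : k)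
    (𝓛₁ : Set (Module.Dual ℂ (CuspForm (Gamma0 M₁) 2) → k))
    (𝓛₂ : Set (Module.Dual ℂ (CuspForm (Gamma0 M₂) 2) → k))
    (𝓛₀ : Set (Module.Dual ℂ (CuspForm (Gamma0 M₀) 2) → k))
    (hadd₁ : ∀ Λ ∈ 𝓛₁, ∀ x ∈ periodHomology M₁, ∀ y ∈ periodHomology M₁, Λ (x + y) = Λ x + Λ y)
    (hadd₂ : ∀ Λ ∈ 𝓛₂, ∀ x ∈ periodHomology M₂, ∀ y ∈ periodHomology M₂, Λ (x + y) = Λ x + Λ y)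
    -- stability of `𝓛₁, 𝓛₂` under composition with the closing operator and under differences
    (hA₁ : ∀ Λ ∈ 𝓛₁, (fun x ↦ Λ (HeckeRing0.T M₁ 2 q₀ hq₀ • x - ((q₀ + 1 : ℕ) : ℂ) • x)) ∈ 𝓛₁)
    (hA₂ : ∀ Λ ∈ 𝓛₂, (fun x ↦ Λ (HeckeRing0.T M₂ 2 q₀ hq₀ • x - ((q₀ + 1 : ℕ) : ℂ) • x)) ∈ 𝓛₂)
    (hsub₁ : ∀ Λ ∈ 𝓛₁, ∀ Λ' ∈ 𝓛₁, (fun x ↦ Λ x - Λ' x) ∈ 𝓛₁)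
    (hsub₂ : ∀ Λ ∈ 𝓛₂, ∀ Λ' ∈ 𝓛₂, (fun x ↦ Λ x - Λ' x) ∈ 𝓛₂)
    -- pull-backs of `𝓛₀` lie in `𝓛₁`, `𝓛₂`
    (hpull₁ : ∀ Λ₀ ∈ 𝓛₀, (fun x ↦ Λ₀ ((degeneracyMap0 M₀ M₁ 1 2).dualMap x) -
      w₂ * Λ₀ ((degeneracyMap0 M₀ M₁ ℓ₂ 2).dualMap x)) ∈ 𝓛₁)
    (hpull₂ : ∀ Λ₀ ∈ 𝓛₀, (fun x ↦ -(Λ₀ ((degeneracyMap0 M₀ M₂ 1 2).dualMap x) -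
      w₁ * Λ₀ ((degeneracyMap0 M₀ M₂ ℓ₁ 2).dualMap x))) ∈ 𝓛₂)
    -- `A`-support of `𝓛₁, 𝓛₂` and `A`-surjectivity on `𝓛₀`
    (hsupp₁ : ∀ Λ ∈ 𝓛₁, (∀ x ∈ periodHomology M₁,
      Λ (HeckeRing0.T M₁ 2 q₀ hq₀ • x - ((q₀ + 1 : ℕ) : ℂ) • x) = 0) → ∀ x ∈ periodHomology M₁, Λ x = 0)
    (hsupp₂ : ∀ Λ ∈ 𝓛₂, (∀ x ∈ periodHomology M₂,
      Λ (HeckeRing0.T M₂ 2 q₀ hq₀ • x - ((q₀ + 1 : ℕ) : ℂ) • x) = 0) → ∀ x ∈ periodHomology M₂, Λ x = 0)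
    (hsurj₀ : ∀ Λ₀' ∈ 𝓛₀, ∃ Λ₀ ∈ 𝓛₀, ∀ x ∈ periodHomology M₀,
      Λ₀ (HeckeRing0.T M₀ 2 q₀ hq₀ • x - ((q₀ + 1 : ℕ) : ℂ) • x) = Λ₀' x)
    -- CYCLE-LEVEL EXACTNESS
    (hexactC : ∀ Λ₁ ∈ 𝓛₁, ∀ Λ₂ ∈ 𝓛₂,
      (∀ y ∈ periodHomology N,
        (Λ₁ ((degeneracyMap0 M₁ N 1 2).dualMap y) - w₁ * Λ₁ ((degeneracyMap0 M₁ N ℓ₁ 2).dualMap y)) +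
        (Λ₂ ((degeneracyMap0 M₂ N 1 2).dualMap y) - w₂ * Λ₂ ((degeneracyMap0 M₂ N ℓ₂ 2).dualMap y)) = 0) →
      ∃ Λ₀ ∈ 𝓛₀,
        (∀ x ∈ periodHomology M₁, Λ₁ x = Λ₀ ((degeneracyMap0 M₀ M₁ 1 2).dualMap x) -
          w₂ * Λ₀ ((degeneracyMap0 M₀ M₁ ℓ₂ 2).dualMap x)) ∧
        (∀ x ∈ periodHomology M₂, Λ₂ x = -(Λ₀ ((degeneracyMap0 M₀ M₂ 1 2).dualMap x) -
          w₁ * Λ₀ ((degeneracyMap0 M₀ M₂ ℓ₁ 2).dualMap x)))) :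
    -- CONCLUSION: `hexact` for the path-function sets
    ∀ g ∈ {μ : ℚ → k | ∃ Λ ∈ 𝓛₁, ∀ r, μ r = Λ (HeckeRing0.T M₁ 2 q₀ hq₀ • σ1 r - ((q₀ + 1 : ℕ) : ℂ) • σ1 r)},
    ∀ h ∈ {μ : ℚ → k | ∃ Λ ∈ 𝓛₂, ∀ r, μ r = Λ (HeckeRing0.T M₂ 2 q₀ hq₀ • σ2 r - ((q₀ + 1 : ℕ) : ℂ) • σ2 r)},
      (∀ r, (g r - w₁ * g (ℓ₁ * r)) + (h r - w₂ * h (ℓ₂ * r)) = 0) →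
      ∃ z ∈ {μ : ℚ → k | ∃ Λ ∈ 𝓛₀, ∀ r, μ r = Λ (HeckeRing0.T M₀ 2 q₀ hq₀ • σ0 r - ((q₀ + 1 : ℕ) : ℂ) • σ0 r)},
        (g = fun r ↦ z r - w₂ * z (ℓ₂ * r)) ∧ (h = fun r ↦ -(z r - w₁ * z (ℓ₁ * r))) := by
  intro g hg h hh hsum
  obtain ⟨Λ₁, hΛ₁, hg⟩ := hg
  obtain ⟨Λ₂, hΛ₂, hh⟩ := hh
  -- divisibilities and congruences at the lower levels
  have hM1N : M₁ ∣ N := by simpa using h1N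
  have hM2N : M₂ ∣ N := by simpa using h2N
  have hM01 : M₀ ∣ M₁ := by simpa using h01
  have hq₀1M1 : q₀ ≡ 1 [MOD M₁] := hq₀1.of_dvd hM1N
  have hq₀1M2 : q₀ ≡ 1 [MOD M₂] := hq₀1.of_dvd hM2N
  have hq₀1M0 : q₀ ≡ 1 [MOD M₀] := hq₀1M1.of_dvd hM01
  have hq₀M1 : ¬ q₀ ∣ M₁ := fun hd ↦ hq₀N (dvd_trans hd hM1N)
  have hq₀M2 : ¬ q₀ ∣ M₂ := fun hd ↦ hq₀N (dvd_trans hd hM2N)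
  -- closing operators land in `H₁`
  have hcl1 : ∀ r, HeckeRing0.T M₁ 2 q₀ hq₀ • σ1 r - ((q₀ + 1 : ℕ) : ℂ) • σ1 r ∈ periodHomology M₁ :=
    T_smul_sub_smul_symbol_mem_periodHomology M₁ σ1 hσ1 hq₀ hq₀1M1
  have hcl2 : ∀ r, HeckeRing0.T M₂ 2 q₀ hq₀ • σ2 r - ((q₀ + 1 : ℕ) : ℂ) • σ2 r ∈ periodHomology M₂ :=
    T_smul_sub_smul_symbol_mem_periodHomology M₂ σ2 hσ2 hq₀ hq₀1M2
  -- the composed functionals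
  set Λ₁' : Module.Dual ℂ (CuspForm (Gamma0 M₁) 2) → k :=
    fun x ↦ Λ₁ (HeckeRing0.T M₁ 2 q₀ hq₀ • x - ((q₀ + 1 : ℕ) : ℂ) • x) with hΛ₁'
  set Λ₂' : Module.Dual ℂ (CuspForm (Gamma0 M₂) 2) → k :=
    fun x ↦ Λ₂ (HeckeRing0.T M₂ 2 q₀ hq₀ • x - ((q₀ + 1 : ℕ) : ℂ) • x) with hΛ₂'
  -- STEP 1: the function identity, read through `pathFun_sub_smul_comp_eq'`, on the closed symbols
  have hkill : ∀ r,
      (Λ₁' ((degeneracyMap0 M₁ N 1 2).dualMap (σN r)) -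
          w₁ * Λ₁' ((degeneracyMap0 M₁ N ℓ₁ 2).dualMap (σN r))) +
        (Λ₂' ((degeneracyMap0 M₂ N 1 2).dualMap (σN r)) -
          w₂ * Λ₂' ((degeneracyMap0 M₂ N ℓ₂ 2).dualMap (σN r))) = 0 := by
    intro r
    have e1 := pathFun_sub_smul_comp_eq' h1N h1N' Λ₁ σ1 hσ1 σN hσN hq₀ hq₀N 1 w₁ g
      (fun r ↦ by rw [hg r, one_mul]) r
    have e2 := pathFun_sub_smul_comp_eq' h2N h2N' Λ₂ σ2 hσ2 σN hσN hq₀ hq₀N 1 w₂ h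
      (fun r ↦ by rw [hh r, one_mul]) r
    have hs := hsum r
    rw [e1, e2, one_mul, one_mul] at hs
    simp only at hs
    rw [hΛ₁', hΛ₂']
    simp only
    rw [← dualMap_degeneracyMap0_closing h1N hq₀ hq₀N, ← dualMap_degeneracyMap0_closing h1N' hq₀ hq₀N,
      ← dualMap_degeneracyMap0_closing h2N hq₀ hq₀N, ← dualMap_degeneracyMap0_closing h2N' hq₀ hq₀N]
    exact hs
  -- STEP 2: from the closed symbols to all cycles of level `N` (every cycle is ONE period functional)
  have hkillH : ∀ y ∈ periodHomology N,
      (Λ₁' ((degeneracyMap0 M₁ N 1 2).dualMap y) - w₁ * Λ₁' ((degeneracyMap0 M₁ N ℓ₁ 2).dualMap y)) +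
        (Λ₂' ((degeneracyMap0 M₂ N 1 2).dualMap y) - w₂ * Λ₂' ((degeneracyMap0 M₂ N ℓ₂ 2).dualMap y)) = 0 := by
    -- both sides are additive in `y` ∈ `H₁(X₀(N))`… we only need the values on `A•y`; but the hypothesis
    -- of `hexactC` is on ALL cycles: apply it to `Λ_i'`, whose values on `d y` are the values of `Λ_i` on
    -- `d (A y)`; so we prove the statement for `Λ_i'` directly from `hkill` via `y = {∞, γ∞}`.
    intro y hy
    rcases exists_eq_zero_or_eq_symbol_of_mem_periodHomology σN hσN hy with rfl | ⟨r, rfl⟩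
    · simp only [map_zero, hΛ₁', hΛ₂', smul_zero, sub_zero]
      rw [apply_zero_of_additiveOn' Λ₁ (hadd₁ Λ₁ hΛ₁), apply_zero_of_additiveOn' Λ₂ (hadd₂ Λ₂ hΛ₂)]
      ring
    · exact hkill r
  -- STEP 3: cycle-exactness for `(Λ₁', Λ₂')`
  obtain ⟨Λ₀', hΛ₀', hΛ₁eq, hΛ₂eq⟩ := hexactC Λ₁' (hA₁ Λ₁ hΛ₁) Λ₂' (hA₂ Λ₂ hΛ₂) hkillH
  -- STEP 4: divide by `A` on `𝓛₀`
  obtain ⟨Λ₀, hΛ₀, hΛ₀A⟩ := hsurj₀ Λ₀' hΛ₀'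
  -- `Λ₁ = Λ₀∘(α − w₂β)_*` on `H₁(X₀(M₁))` by `A`-support of the difference
  have hD1 : ∀ x ∈ periodHomology M₁, Λ₁ x = Λ₀ ((degeneracyMap0 M₀ M₁ 1 2).dualMap x) -
      w₂ * Λ₀ ((degeneracyMap0 M₀ M₁ ℓ₂ 2).dualMap x) := by
    have hmem : (fun x ↦ (fun x ↦ Λ₀ ((degeneracyMap0 M₀ M₁ 1 2).dualMap x) -
        w₂ * Λ₀ ((degeneracyMap0 M₀ M₁ ℓ₂ 2).dualMap x)) x - Λ₁ x) ∈ 𝓛₁ :=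
      hsub₁ _ (hpull₁ Λ₀ hΛ₀) Λ₁ hΛ₁
    have hz := hsupp₁ _ hmem (fun x hx ↦ ?_)
    · intro x hx
      have := hz x hx
      simp only at this
      linear_combination -this
    · -- the difference kills `A•x`
      simp only
      have e := hΛ₁eq x hx
      rw [hΛ₁'] at e
      simp only at e
      rw [dualMap_degeneracyMap0_closing h01 hq₀ hq₀M1, dualMap_degeneracyMap0_closing h01' hq₀ hq₀M1,
        hΛ₀A _ (dualMap_degeneracyMap0_mem_periodHomology M₀ M₁ 1 h01 hx),
        hΛ₀A _ (dualMap_degeneracyMap0_mem_periodHomology M₀ M₁ ℓ₂ h01' hx)]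
      -- `e : Λ₁(A x) = Λ₀'(α x) − w₂ Λ₀'(β x)`
      linear_combination -e
  have hD2 : ∀ x ∈ periodHomology M₂, Λ₂ x = -(Λ₀ ((degeneracyMap0 M₀ M₂ 1 2).dualMap x) -
      w₁ * Λ₀ ((degeneracyMap0 M₀ M₂ ℓ₁ 2).dualMap x)) := by
    have hmem : (fun x ↦ (fun x ↦ -(Λ₀ ((degeneracyMap0 M₀ M₂ 1 2).dualMap x) -
        w₁ * Λ₀ ((degeneracyMap0 M₀ M₂ ℓ₁ 2).dualMap x))) x - Λ₂ x) ∈ 𝓛₂ :=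
      hsub₂ _ (hpull₂ Λ₀ hΛ₀) Λ₂ hΛ₂
    have hz := hsupp₂ _ hmem (fun x hx ↦ ?_)
    · intro x hx
      have := hz x hx
      simp only at this
      linear_combination -this
    · simp only
      have e := hΛ₂eq x hx
      rw [hΛ₂'] at e
      simp only at e
      rw [dualMap_degeneracyMap0_closing h02 hq₀ hq₀M2, dualMap_degeneracyMap0_closing h02' hq₀ hq₀M2,
        hΛ₀A _ (dualMap_degeneracyMap0_mem_periodHomology M₀ M₂ 1 h02 hx),
        hΛ₀A _ (dualMap_degeneracyMap0_mem_periodHomology M₀ M₂ ℓ₁ h02' hx)]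
      linear_combination -e
  -- STEP 5: the witness `z = μ_{Λ₀}`
  refine ⟨fun r ↦ Λ₀ (HeckeRing0.T M₀ 2 q₀ hq₀ • σ0 r - ((q₀ + 1 : ℕ) : ℂ) • σ0 r), ⟨Λ₀, hΛ₀, fun r ↦ rfl⟩,
    ?_, ?_⟩
  · funext r
    have ez := pathFun_sub_smul_comp_eq' h01 h01' Λ₀ σ0 hσ0 σ1 hσ1 hq₀ hq₀M1 1 w₂
      (fun r ↦ Λ₀ (HeckeRing0.T M₀ 2 q₀ hq₀ • σ0 r - ((q₀ + 1 : ℕ) : ℂ) • σ0 r))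
      (fun r ↦ by rw [one_mul]) r
    rw [one_mul] at ez
    rw [ez, hg r, hD1 _ (hcl1 r)]
  · funext r
    have ez := pathFun_sub_smul_comp_eq' h02 h02' Λ₀ σ0 hσ0 σ2 hσ2 hq₀ hq₀M2 1 w₁
      (fun r ↦ Λ₀ (HeckeRing0.T M₀ 2 q₀ hq₀ • σ0 r - ((q₀ + 1 : ℕ) : ℂ) • σ0 r))
      (fun r ↦ by rw [one_mul]) r
    rw [one_mul] at ez
    rw [ez, hh r, hD2 _ (hcl2 r)]

end ExactOfCycles

end Summit.BirchSwinnertonDyer.Rank1Residual.LevelLowering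

end
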